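import Mathlib
import HarnessLib

/-!
# TwoNotchVacuumPhaseLock — the vacuum phase lock of the PERMISSIVE multi-notch K book (STAGING; nogo gen 18, PBOOK-ADDENDUM-1 §1 L5)

search for candidate a priori estimates; no regularity claim.

Setting (prose dictionary, as in `TwoNotchExactDescent`): p = 1 (one +d main `P`, one −d main `M`), chords move with
dx/dy = v = −T(mid-state) for a velocity law `T` (the model: `T = tan`; everything below except the `tan` corollaries holds for ANY
strictly increasing `T`). A VACUUM EPISODE `(χ, a)` runs `[+d −d] → birth of an a-pair (0 < a < d) of chirality χ at M → sibling meal at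
P → [+d −d]` with no other chord alive; `s` = base director value before the episode. Outside episodes M and P have the same mid-state
`s + d/2`, hence equal velocity: the rightward gap `h = x_P − x_M ∈ (0,1)` (circumference 1) is FROZEN. During a B-episode the right
member r = −a (mid `s + a/2`) runs to P (mid `s + d/2`, velocity unchanged until the meal — a chord's mid-state changes only at events it
hosts) while the left member ℓ = +a (mid `s + d + a/2`) goes round the other way; they flank P simultaneously (sibling meal) iff
`(v_r − v_ℓ)·τ = 1` and `h·(v_r − v_ℓ) = v_r − v_P` (`start_gap_of_meeting`), and afterwards the frozen gap is
`(v_r − v_M′)/(v_r − v_ℓ)` with M′ = M after the birth (mid `s + d/2 + a`) (`end_gap_of_meeting`). In terms of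
`gapRatio T m d x = (T m − T x)/(T (x+d) − T x)`:
  start(B,a,s) = gapRatio T (s + d/2) d (s + a/2),      end(B,a,s) = gapRatio T (s + a + d/2) d (s + a/2)   (base afterwards s + a),
  start(A,a,s) = gapRatio T (s + d/2) d (s − a/2),      end(A,a,s) = gapRatio T (s − a + d/2) d (s − a/2)   (base afterwards s − a).
THE LOCK: `gapRatio T m d` is strictly decreasing on `(m − d, m)` for strictly increasing `T` (`gapRatio_lt_of_lt`, from the purely
algebraic `lock_core`); consequently two CONSECUTIVE vacuum episodes are compatible iff they have the SAME level and OPPOSITE chirality,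
identically in the tilt `s` (`after_B_start_A_iff`, `after_B_not_B`, mirrors), which is the permissive-book form of one-notch alternation
and explains the dominant timing-inconsistency certificate of the permissive census (PBOOK-ADDENDUM-1 §3). Engine check: class (1,4,2,8).
Nothing here is about Navier–Stokes; it is a statement about the toy chord gas of the K-functional programme.
-/

namespace Summit.NavierStokesRegularity.FunctionalMining.TwoNotchVacuumPhaseLock

/-- The gap ratio `(T m − T x)/(T (x + d) − T x)`. -/
noncomputable def gapRatio (T : ℝ → ℝ) (m d x : ℝ) : ℝ := (T m - T x) / (T (x + d) - T x)

/-- Algebraic core of the lock: for `a < c < M < b < e`, `(M − c)/(e − c) < (M − a)/(b − a)`. -/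
theorem lock_core (a c M b e : ℝ) (hac : a < c) (hcM : c < M) (hMb : M < b) (hbe : b < e) :
    (M - c) / (e - c) < (M - a) / (b - a) := by
  have hec : 0 < e - c := by linarith
  have hba : 0 < b - a := by linarith
  have key : 0 < (M - a) * (e - c) - (b - a) * (M - c) := by
    have : (M - a) * (e - c) - (b - a) * (M - c) = (M - a) * (e - b) + (c - a) * (b - M) := by ring
    rw [this]
    exact add_pos (mul_pos (by linarith) (by linarith)) (mul_pos (by linarith) (by linarith))
  have hsub : (M - a) / (b - a) - (M - c) / (e - c) = ((M - a) * (e - c) - (b - a) * (M - c)) / ((b - a) * (e - c)) :=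
    div_sub_div _ _ (ne_of_gt hba) (ne_of_gt hec)
  have hpos : 0 < (M - a) / (b - a) - (M - c) / (e - c) := by
    rw [hsub]; exact div_pos key (mul_pos hba hec)
  linarith

/-- Strict decrease of the gap ratio on `(m − d, m)` for a velocity law strictly increasing on an interval `I`
containing all the arguments. -/
theorem gapRatio_lt_of_lt {T : ℝ → ℝ} {I : Set ℝ} (hT : StrictMonoOn T I) (m d x y : ℝ)
    (hx : x ∈ I) (hy : y ∈ I) (hm : m ∈ I) (hxd : x + d ∈ I) (hyd : y + d ∈ I)
    (hxy : x < y) (hym : y < m) (hmx : m < x + d) :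
    gapRatio T m d y < gapRatio T m d x := by
  unfold gapRatio
  have h1 : T x < T y := hT hx hy hxy
  have h2 : T y < T m := hT hy hm hym
  have h3 : T m < T (x + d) := hT hm hxd hmx
  have h4 : T (x + d) < T (y + d) := hT hxd hyd (by linarith)
  exact lock_core (T x) (T y) (T m) (T (x + d)) (T (y + d)) h1 h2 h3 h4

/-- Injectivity form: equal gap ratios at two admissible points force the points to coincide. -/
theorem gapRatio_eq_iff {T : ℝ → ℝ} {I : Set ℝ} (hT : StrictMonoOn T I) (m d x y : ℝ)
    (hx : x ∈ I) (hy : y ∈ I) (hm : m ∈ I) (hxd : x + d ∈ I) (hyd : y + d ∈ I)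
    (hxm : x < m) (hmx : m < x + d) (hym : y < m) (hmy : m < y + d) :
    gapRatio T m d x = gapRatio T m d y ↔ x = y := by
  constructor
  · intro h
    by_contra hne
    rcases lt_or_gt_of_ne hne with hlt | hgt
    · exact absurd h (ne_of_gt (gapRatio_lt_of_lt hT m d x y hx hy hm hxd hyd hlt hym hmx))
    · exact absurd h (ne_of_lt (gapRatio_lt_of_lt hT m d y x hy hx hm hyd hxd hgt hxm hmy))
  · intro h; rw [h]

/-! ## Kinematics of one episode (affine motion between events) -/

/-- Start gap of a sibling wrap-meal: members start at `x₀` with velocities `vr`, `vl`, the absorber starts at `x₀ + h` with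
velocity `vP`; if at height `τ` the right member reaches the absorber and the left member reaches it from one turn behind,
then `(vr − vl)·τ = 1` and `h·(vr − vl) = vr − vP`. -/
theorem start_gap_of_meeting (x₀ h vr vl vP τ : ℝ)
    (hr : x₀ + vr * τ = x₀ + h + vP * τ) (hl : x₀ + vl * τ = x₀ + h + vP * τ - 1) :
    (vr - vl) * τ = 1 ∧ h * (vr - vl) = vr - vP := by
  constructor
  · linarith
  · have hτ : (vr - vl) * τ = 1 := by linarith
    have hh : h = (vr - vP) * τ := by linarith
    rw [hh]
    calc (vr - vP) * τ * (vr - vl) = (vr - vP) * ((vr - vl) * τ) := by ring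
      _ = vr - vP := by rw [hτ, mul_one]

/-- End gap: with the host moving as `x₀ + vM·y` after the birth, the gap absorber − host at the meal is `(vr − vM)·τ`,
i.e. `gap·(vr − vl) = vr − vM`. -/
theorem end_gap_of_meeting (x₀ h vr vl vP vM τ : ℝ)
    (hr : x₀ + vr * τ = x₀ + h + vP * τ) (hl : x₀ + vl * τ = x₀ + h + vP * τ - 1) :
    ((x₀ + h + vP * τ) - (x₀ + vM * τ)) * (vr - vl) = vr - vM := by
  have hτ : (vr - vl) * τ = 1 := by linarith
  have : (x₀ + h + vP * τ) - (x₀ + vM * τ) = (vr - vM) * τ := by linarith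
  rw [this]
  calc (vr - vM) * τ * (vr - vl) = (vr - vM) * ((vr - vl) * τ) := by ring
    _ = vr - vM := by rw [hτ, mul_one]

/-- With the velocity law `v = −T(mid)`, the start gap `(vr − vP)/(vr − vl)` of a B-episode (mids: r = s + a/2, P = s + d/2,
ℓ = s + d + a/2) is `gapRatio T (s + d/2) d (s + a/2)`. -/
theorem startB_eq (T : ℝ → ℝ) (s d a : ℝ) :
    (-T (s + a/2) - -T (s + d/2)) / (-T (s + a/2) - -T (s + d + a/2)) = gapRatio T (s + d/2) d (s + a/2) := by
  unfold gapRatio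
  have e1 : -T (s + a/2) - -T (s + d/2) = T (s + d/2) - T (s + a/2) := by ring
  have e2 : -T (s + a/2) - -T (s + d + a/2) = T (s + a/2 + d) - T (s + a/2) := by rw [show s + d + a/2 = s + a/2 + d by ring]; ring
  rw [e1, e2]

/-- End gap of a B-episode (host mid after the birth `s + d/2 + a`): `gapRatio T (s + a + d/2) d (s + a/2)`. -/
theorem endB_eq (T : ℝ → ℝ) (s d a : ℝ) :
    (-T (s + a/2) - -T (s + d/2 + a)) / (-T (s + a/2) - -T (s + d + a/2)) = gapRatio T (s + a + d/2) d (s + a/2) := by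
  unfold gapRatio
  rw [show s + d/2 + a = s + a + d/2 by ring, show s + d + a/2 = s + a/2 + d by ring]; ring

/-- Start gap of an A-episode (mids: r = +a at `s − a/2`, P at `s + d/2`, ℓ = −a at `s + d − a/2`). -/
theorem startA_eq (T : ℝ → ℝ) (s d a : ℝ) :
    (-T (s - a/2) - -T (s + d/2)) / (-T (s - a/2) - -T (s + d - a/2)) = gapRatio T (s + d/2) d (s - a/2) := by
  unfold gapRatio
  rw [show s + d - a/2 = s - a/2 + d by ring]; ring

/-- End gap of an A-episode (host mid after the birth `s + d/2 − a`). -/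
theorem endA_eq (T : ℝ → ℝ) (s d a : ℝ) :
    (-T (s - a/2) - -T (s + d/2 - a)) / (-T (s - a/2) - -T (s + d - a/2)) = gapRatio T (s - a + d/2) d (s - a/2) := by
  unfold gapRatio
  rw [show s + d/2 - a = s - a + d/2 by ring, show s + d - a/2 = s - a/2 + d by ring]; ring

/-! ## The four episode gaps as functions of (base `s`, main size `d`, level `a`) -/

/-- Gap needed to START a B-episode of level `a` at base `s`. -/
noncomputable def startB (T : ℝ → ℝ) (s d a : ℝ) : ℝ := gapRatio T (s + d/2) d (s + a/2)
/-- Frozen gap LEFT by a B-episode of level `a` started at base `s` (base afterwards `s + a`). -/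
noncomputable def endB (T : ℝ → ℝ) (s d a : ℝ) : ℝ := gapRatio T (s + a + d/2) d (s + a/2)
/-- Gap needed to START an A-episode of level `a` at base `s`. -/
noncomputable def startA (T : ℝ → ℝ) (s d a : ℝ) : ℝ := gapRatio T (s + d/2) d (s - a/2)
/-- Frozen gap LEFT by an A-episode of level `a` started at base `s` (base afterwards `s − a`). -/
noncomputable def endA (T : ℝ → ℝ) (s d a : ℝ) : ℝ := gapRatio T (s - a + d/2) d (s - a/2)

/-- The clockwork identity: an A-episode of the SAME level right after a B-episode always fits (any law, any tilt). -/
theorem startA_after_B (T : ℝ → ℝ) (s d a : ℝ) : startA T (s + a) d a = endB T s d a := by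
  unfold startA endB; rw [show s + a - a/2 = s + a/2 by ring]

/-- Mirror: a B-episode of the same level right after an A-episode always fits. -/
theorem startB_after_A (T : ℝ → ℝ) (s d a : ℝ) : startB T (s - a) d a = endA T s d a := by
  unfold startB endA; rw [show s - a + a/2 = s - a/2 by ring]

/-! ## The lock (strictly increasing law on an interval `I` containing the band `[s − d, s + 3d]`) -/

section lock
variable {T : ℝ → ℝ} {I : Set ℝ}

/-- After a B-episode (level `a`, base `s`), a B-episode of ANY level `b` cannot start: the frozen gap is too large. -/
theorem after_B_not_B (hT : StrictMonoOn T I) (s d a b : ℝ)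
    (ha : 0 < a) (had : a < d) (hb : 0 < b) (hbd : b < d)
    (hI : Set.Icc (s - d) (s + 3 * d) ⊆ I) :
    startB T (s + a) d b < endB T s d a := by
  unfold startB endB
  have key := gapRatio_lt_of_lt hT (s + a + d/2) d (s + a/2) (s + a + b/2)
    (hI ⟨by linarith, by linarith⟩) (hI ⟨by linarith, by linarith⟩) (hI ⟨by linarith, by linarith⟩)
    (hI ⟨by linarith, by linarith⟩) (hI ⟨by linarith, by linarith⟩) (by linarith) (by linarith) (by linarith)
  simpa using key

/-- After a B-episode (level `a`, base `s`), an A-episode of level `b` fits iff `b = a`. -/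
theorem after_B_start_A_iff (hT : StrictMonoOn T I) (s d a b : ℝ)
    (ha : 0 < a) (had : a < d) (hb : 0 < b) (hbd : b < d)
    (hI : Set.Icc (s - d) (s + 3 * d) ⊆ I) :
    startA T (s + a) d b = endB T s d a ↔ b = a := by
  unfold startA endB
  have key := gapRatio_eq_iff hT (s + a + d/2) d (s + a - b/2) (s + a/2)
    (hI ⟨by linarith, by linarith⟩) (hI ⟨by linarith, by linarith⟩) (hI ⟨by linarith, by linarith⟩)
    (hI ⟨by linarith, by linarith⟩) (hI ⟨by linarith, by linarith⟩) (by linarith) (by linarith) (by linarith) (by linarith)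
  rw [key]; constructor <;> intro h <;> linarith

/-- After an A-episode (level `a`, base `s`), an A-episode of ANY level `b` cannot start: the frozen gap is too small. -/
theorem after_A_not_A (hT : StrictMonoOn T I) (s d a b : ℝ)
    (ha : 0 < a) (had : a < d) (hb : 0 < b) (hbd : b < d)
    (hI : Set.Icc (s - 2 * d) (s + 2 * d) ⊆ I) :
    endA T s d a < startA T (s - a) d b := by
  unfold startA endA
  have key := gapRatio_lt_of_lt hT (s - a + d/2) d (s - a - b/2) (s - a/2)
    (hI ⟨by linarith, by linarith⟩) (hI ⟨by linarith, by linarith⟩) (hI ⟨by linarith, by linarith⟩)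
    (hI ⟨by linarith, by linarith⟩) (hI ⟨by linarith, by linarith⟩) (by linarith) (by linarith) (by linarith)
  simpa using key

/-- After an A-episode (level `a`, base `s`), a B-episode of level `b` fits iff `b = a`. -/
theorem after_A_start_B_iff (hT : StrictMonoOn T I) (s d a b : ℝ)
    (ha : 0 < a) (had : a < d) (hb : 0 < b) (hbd : b < d)
    (hI : Set.Icc (s - 2 * d) (s + 2 * d) ⊆ I) :
    startB T (s - a) d b = endA T s d a ↔ b = a := by
  unfold startB endA
  have key := gapRatio_eq_iff hT (s - a + d/2) d (s - a + b/2) (s - a/2)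
    (hI ⟨by linarith, by linarith⟩) (hI ⟨by linarith, by linarith⟩) (hI ⟨by linarith, by linarith⟩)
    (hI ⟨by linarith, by linarith⟩) (hI ⟨by linarith, by linarith⟩) (by linarith) (by linarith) (by linarith) (by linarith)
  rw [key]; constructor <;> intro h <;> linarith

end lock

/-! ## The model law `T = tan` on `(−π/2, π/2)` -/

/-- `tan` is strictly increasing on `(−π/2, π/2)` (Mathlib), so every statement of the `lock` section applies with
`I = Set.Ioo (−π/2) (π/2)` as soon as the band `[s − 2d, s + 3d]` lies inside it. Recorded instance: after a B-episode an
A-episode fits iff it has the same level. -/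
theorem tan_after_B_start_A_iff (s d a b : ℝ) (ha : 0 < a) (had : a < d) (hb : 0 < b) (hbd : b < d)
    (hlo : -(Real.pi / 2) < s - d) (hhi : s + 3 * d < Real.pi / 2) :
    startA Real.tan (s + a) d b = endB Real.tan s d a ↔ b = a :=
  after_B_start_A_iff Real.strictMonoOn_tan s d a b ha had hb hbd
    (fun x hx => ⟨by linarith [hx.1], by linarith [hx.2]⟩)

/-- Recorded instance: after a B-episode no B-episode of any level fits (for `tan`). -/
theorem tan_after_B_not_B (s d a b : ℝ) (ha : 0 < a) (had : a < d) (hb : 0 < b) (hbd : b < d)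
    (hlo : -(Real.pi / 2) < s - d) (hhi : s + 3 * d < Real.pi / 2) :
    startB Real.tan (s + a) d b < endB Real.tan s d a :=
  after_B_not_B Real.strictMonoOn_tan s d a b ha had hb hbd
    (fun x hx => ⟨by linarith [hx.1], by linarith [hx.2]⟩)

end Summit.NavierStokesRegularity.FunctionalMining.TwoNotchVacuumPhaseLock
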